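import Summits.AtomisticToContinuum.Crystallization.Theorems.LoopTunnelDialContactLaw
import Summits.AtomisticToContinuum.Crystallization.Theorems.LoopTunnelDialContactFloor

/-!
# LoopTunnelDial — HOT ⟸ PUSH ∧ LOAD: the directional split of the contact law (lens-5 g18 → g19 material; crux `PocketCase`, stmt-AtomisticToContinuum-27294)

Landing kit file 6 (lands after files 2 and 3).  The CONTACT LAW `ContactHot ρ b` (stub 3 of the contact dial is `ContactHotAbove (3/4)`) is reduced,
with PROVED glue, to two ONE-CENTRE, ground-state-free capacity constants:

* PUSH `PushCost ρ κ` — at a force-balanced particle `p` of an injective `7/10`-separated configuration with a partner `q` at distance `< ρ`, the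
  PUSHERS of `p` (particles `m ≠ q` closer than `0.89 = 2^{-1/6}⁺`, where `h_LJ < 0`, and BEHIND `p` as seen from `q`: `⟪y m − y p, y q − y p⟫ < 0`) carry
  positive energy at least `κ/12`:  `κ ≤ ∑_{pushers} (−h(r_{pm}))`.  Heuristic value at `ρ = 3/4`: `κ ≈ 20` (the push `h′(3/4) = 416` of the partner must be
  returned by few particles in the back cap; one pusher straight behind at `3/4` costs `−h(3/4) = 20.33`, two at `0.78` cost `21.6`, three at `0.80` cost
  `20.8`, four at `0.81` cost `21.3`; back-shell particles at `r ∈ [0.89, 1)` push at most `22|cos|` each and the FRONT kissing shell pushes the wrong way).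
* LOAD `LoadCapNP ρ Λ` — the minus-energy load `∑ h(r_{pm})` over the NON-pushers `m ≠ q` is `≤ Λ` (a pure packing capacity of `h = 2r⁻⁶ − r⁻¹²` over
  `7/10`-separated families; putative supremum `≈ 42` with no exclusions — kissing shell `≤ 25` points at `r ≈ 1` × `h ≤ 1`, second shell `≈ 55 × 0.2`,
  rest `≈ 6` — and `≈ 31` once the caps shadowed by `q` and by the pusher are excluded).

GLUE (proved below): `PushCost ρ κ ∧ LoadCapNP ρ Λ ∧ (h ≤ H on [7/10, ρ)) ⟹ ContactHot ρ (−(H − κ + Λ)/12)`; at `ρ = 3/4`, `H = h(3/4) = −20.33…`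
(`h` is increasing on `(0,1)`), so HOT at `3/4` (floor `> −0.711 ≥ e⋆`) follows from `Λ − κ < 28.86`.  Both constants are INSTRUMENTABLE (census:
putative `κ(ρ)`, `Λ(ρ)` by annealing; certified by interval branch-and-bound over `≤ 8` pushers resp. a spherical-code count).  All `[folklore]`; 0 sorry.
-/

noncomputable section

open scoped BigOperators Classical InnerProductSpace
open Literature.MathematicalPhysics.StatisticalMechanics
open Literature.MathematicalPhysics.StatisticalMechanics.Yuhjtman2015 (hLJ)
open Summit.AtomisticToContinuum.Crystallization.Theorems.GrainPercolationDialCrossCeiling (E3)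
open Summit.AtomisticToContinuum.Crystallization.Theorems.ChargedEnergyGapNegative (eStar)
open Summit.AtomisticToContinuum.Crystallization.Theorems.LjLaminarWindowsSketch (hLJ')
open Summit.AtomisticToContinuum.Crystallization.Theorems.LoopTunnelDialContactLaw
open Summit.AtomisticToContinuum.Crystallization.Theorems.LoopTunnelDialContactFloor

namespace Summit.AtomisticToContinuum.Crystallization.Theorems.LoopTunnelDialHotSplit

variable {N : ℕ}

/-- `IsPusher y p q m`: particle `m` is a PUSHER of `p` relative to its partner `q` — closer to `p` than `89/100` (so `h_LJ(r_{pm}) < 0`) and in the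
back half-space (`⟪y m − y p, y q − y p⟫ < 0`). [line vocabulary · LoopTunnelDial contact dial · crux stmt-AtomisticToContinuum-27294 · definition, not a cited fact] -/
def IsPusher (y : Fin N → E3) (p q m : Fin N) : Prop :=
  dist (y p) (y m) < 89 / 100 ∧ ⟪y m - y p, y q - y p⟫_ℝ < 0

/-- The pushers of `p` relative to `q` among the particles other than `p, q`. [line vocabulary · LoopTunnelDial contact dial · crux stmt-AtomisticToContinuum-27294 · definition, not a cited fact] -/
def pushers (y : Fin N → E3) (p q : Fin N) : Finset (Fin N) :=
  ((Finset.univ.erase p).erase q).filter (fun m => IsPusher y p q m)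

/-- The non-pushers of `p` relative to `q` among the particles other than `p, q`. [line vocabulary · LoopTunnelDial contact dial · crux stmt-AtomisticToContinuum-27294 · definition, not a cited fact] -/
def nonPushers (y : Fin N → E3) (p q : Fin N) : Finset (Fin N) :=
  ((Finset.univ.erase p).erase q).filter (fun m => ¬ IsPusher y p q m)

/-- PUSH `PushCost ρ κ`: at a force-balanced particle `p` of an injective `7/10`-separated configuration with a partner at distance `< ρ`, the pushers
carry minus-energy at most `−κ`, i.e. `κ ≤ ∑_{pushers} (−h(r_{pm}))`.  One-centre, ground-state-free. [line vocabulary · LoopTunnelDial contact dial · crux stmt-AtomisticToContinuum-27294 · definition, not a cited fact] -/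
def PushCost (ρ κ : ℝ) : Prop :=
  ∀ (N : ℕ) (y : Fin N → E3), Function.Injective y → (∀ i j : Fin N, i ≠ j → (7 : ℝ) / 10 ≤ dist (y i) (y j)) →
    ∀ p q : Fin N, p ≠ q → dist (y p) (y q) < ρ → ForceBalancedAt y p →
      κ ≤ ∑ m ∈ pushers y p q, -hLJ (dist (y p) (y m))

/-- LOAD `LoadCapNP ρ Λ`: in an injective `7/10`-separated configuration, at a particle `p` with a partner `q` at distance `< ρ`, the minus-energy load
of the NON-pushers is at most `Λ`.  One-centre, ground-state-free, no force balance used (a pure packing capacity). [line vocabulary · LoopTunnelDial contact dial · crux stmt-AtomisticToContinuum-27294 · definition, not a cited fact] -/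
def LoadCapNP (ρ Λ : ℝ) : Prop :=
  ∀ (N : ℕ) (y : Fin N → E3), Function.Injective y → (∀ i j : Fin N, i ≠ j → (7 : ℝ) / 10 ≤ dist (y i) (y j)) →
    ∀ p q : Fin N, p ≠ q → dist (y p) (y q) < ρ →
      ∑ m ∈ nonPushers y p q, hLJ (dist (y p) (y m)) ≤ Λ

/-- The load over the particles other than `p, q` splits into pushers and non-pushers. [folklore] -/
theorem sum_erase_erase_eq_pushers_add_nonPushers (y : Fin N → E3) (p q : Fin N) (f : Fin N → ℝ) :
    ∑ m ∈ (Finset.univ.erase p).erase q, f m = ∑ m ∈ pushers y p q, f m + ∑ m ∈ nonPushers y p q, f m := by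
  unfold pushers nonPushers
  rw [Finset.sum_filter_add_sum_filter_not]

/-- The minus-energy sum at `p` = partner term + pushers + non-pushers. [folklore] -/
theorem sum_hLJ_eq_partner_pushers_nonPushers (y : Fin N → E3) {p q : Fin N} (hpq : p ≠ q) :
    ∑ m ∈ Finset.univ.erase p, hLJ (dist (y p) (y m)) =
      hLJ (dist (y p) (y q)) + ∑ m ∈ pushers y p q, hLJ (dist (y p) (y m)) + ∑ m ∈ nonPushers y p q, hLJ (dist (y p) (y m)) := by
  have hq : q ∈ Finset.univ.erase p := Finset.mem_erase.2 ⟨hpq.symm, Finset.mem_univ _⟩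
  rw [← Finset.add_sum_erase _ _ hq, sum_erase_erase_eq_pushers_add_nonPushers, add_assoc]

/-- `h_LJ` is monotone increasing on `(0, 1]`: for `0 < a ≤ b ≤ 1`, `h(a) ≤ h(b)`. [folklore] -/
theorem hLJ_mono_of_le_one {a b : ℝ} (ha : 0 < a) (hab : a ≤ b) (hb : b ≤ 1) : hLJ a ≤ hLJ b := by
  unfold hLJ
  have hb0 : 0 < b := lt_of_lt_of_le ha hab
  have h1 : b⁻¹ ≤ a⁻¹ := by rw [inv_le_inv₀ hb0 ha]; exact hab
  have h2 : 1 ≤ b⁻¹ := one_le_inv_iff₀.2 ⟨hb0, hb⟩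
  have h3 : 0 ≤ b⁻¹ := le_trans zero_le_one h2
  -- with u = a⁻¹ ≥ v = b⁻¹ ≥ 1:  2u⁶ − u¹² ≤ 2v⁶ − v¹²  ⟺  (u⁶ − v⁶)(u⁶ + v⁶ − 2) ≥ 0
  have h4 : b⁻¹ ^ 6 ≤ a⁻¹ ^ 6 := pow_le_pow_left₀ h3 h1 6
  have h5 : 1 ≤ b⁻¹ ^ 6 := one_le_pow₀ h2
  nlinarith [mul_nonneg (sub_nonneg.2 h4) (by linarith : (0:ℝ) ≤ a⁻¹ ^ 6 + b⁻¹ ^ 6 - 2)]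

/-- **HOT ⟸ PUSH ∧ LOAD (PROVED GLUE).**  If the pushers cost at least `κ`, the non-pushers load at most `Λ`, and `h ≤ H` on `[7/10, ρ)`, then
`ContactHot ρ (−(H − κ + Λ)/12)`. [folklore] -/
theorem contactHot_of_push_load {ρ κ Λ H : ℝ} (hH : ∀ a : ℝ, 7 / 10 ≤ a → a < ρ → hLJ a ≤ H)
    (hP : PushCost ρ κ) (hL : LoadCapNP ρ Λ) : ContactHot ρ (-(1 / 12) * (H - κ + Λ)) := by
  intro N y hy hsep p q hpq hlt hF
  rw [siteEnergy_eq_sum_hLJ, sum_hLJ_eq_partner_pushers_nonPushers y hpq]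
  have h1 : hLJ (dist (y p) (y q)) ≤ H := hH _ (hsep p q hpq) hlt
  have h2 : ∑ m ∈ pushers y p q, hLJ (dist (y p) (y m)) ≤ -κ := by
    have := hP N y hy hsep p q hpq hlt hF
    rw [Finset.sum_neg_distrib] at this
    linarith
  have h3 := hL N y hy hsep p q hpq hlt
  nlinarith

/-- **HOT at `ρ ≤ 1` from the two dials:** `PushCost ρ κ ∧ LoadCapNP ρ Λ ⟹ ContactHot ρ (−(h(ρ) − κ + Λ)/12)` (`h` increasing below `1`). [folklore] -/
theorem contactHot_of_push_load_le_one {ρ κ Λ : ℝ} (hρ : ρ ≤ 1) (hP : PushCost ρ κ) (hL : LoadCapNP ρ Λ) :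
    ContactHot ρ (-(1 / 12) * (hLJ ρ - κ + Λ)) :=
  contactHot_of_push_load (fun a ha hlt => hLJ_mono_of_le_one (by linarith) hlt.le hρ) hP hL

/-- `h(3/4) < −2032/100 = −20.32`. [folklore] -/
theorem hLJ_threeQuarters_lt : hLJ (3 / 4) < -(2032 / 100) := by
  unfold hLJ; norm_num

/-- **STUB 3 ⟸ PUSH ∧ LOAD at `3/4` (PROVED GLUE):** `PushCost (3/4) κ`, `LoadCapNP (3/4) Λ` and `Λ − κ ≤ 2885/100` give `ContactHot (3/4) b` with a
floor `b > −0.711`, hence `ContactHotAbove (3/4)` once `e⋆ ≤ −0.711` (landed, hub-unbuilt ⇒ hypothesis).  Putative `κ ≈ 20`, `Λ ≈ 31–42`. [folklore] -/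
theorem contactHotAbove_threeQuarters_of_push_load {κ Λ : ℝ} (he : eStar ≤ -(711 / 1000)) (hP : PushCost (3 / 4) κ)
    (hL : LoadCapNP (3 / 4) Λ) (hκΛ : Λ - κ ≤ 2885 / 100) : ContactHotAbove (3 / 4) := by
  have h1 := contactHot_of_push_load_le_one (by norm_num) hP hL
  have h2 := hLJ_threeQuarters_lt
  refine contactHotAbove_of_lt (b := -(1 / 12) * (hLJ (3 / 4) - κ + Λ)) ?_ h1
  nlinarith

/-- The same at a general radius `ρ ≤ 1` with an explicit threshold: `Λ − κ < 8.532 − h(ρ)` suffices for HOT at `ρ` (given `e⋆ ≤ −0.711`). [folklore] -/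
theorem contactHotAbove_of_push_load {ρ κ Λ : ℝ} (hρ : ρ ≤ 1) (he : eStar ≤ -(711 / 1000)) (hP : PushCost ρ κ) (hL : LoadCapNP ρ Λ)
    (hκΛ : Λ - κ + hLJ ρ < 8532 / 1000) : ContactHotAbove ρ := by
  refine contactHotAbove_of_lt (b := -(1 / 12) * (hLJ ρ - κ + Λ)) ?_ (contactHot_of_push_load_le_one hρ hP hL)
  nlinarith

end Summit.AtomisticToContinuum.Crystallization.Theorems.LoopTunnelDialHotSplit

end
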